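import Literature.Computability.Complexity.OracleClockFst
import Literature.Computability.Complexity.OracleSimulateFP
import HarnessLib

/-!
# Tracing an oracle algorithm: its transcript as an output, and as an `FP` string function

Topic `Literature/Computability/Complexity`; companion of `OracleClockFst.lean` (`clockBy`,
`clockFst`: stop after `t w` / `q(|x|)` rounds) and `OracleSimulateFP.lean` (`simFn`: an
emulated run against a polynomial-time answer rule is an `FP` string function). A verifier that
must COMPUTE THE QUERIES of a (non-adaptive) oracle machine on given coins — the Arthur of
Akavia–Goldreich–Goldwasser–Moshkovitz's protocol ("In non-adaptive reductions all queries are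
computed in advance (based solely on the input `w` and the random coins of the reduction)",
STOC 2006, Def. 1; App. D), or of Bogdanov–Trevisan's — needs the TRANSCRIPT of a run as the value
of a polynomial-time function, not only its output. In the transcript model
(`OracleAlg.step : input → answers so far → query ⊕ output`) the answers received are an argument
of the step function, so the device is one more combinator:

* `OracleAlg.traceOut M` — `M` with its output replaced by the code
  `listBool (answers received)` of its transcript of ANSWERS at the moment it halts;
  `queriesAux_traceOut` (same queries), `runAux_traceOut` / `run_traceOut` (if `M` outputs within
  the fuel, `traceOut M` outputs the code of `as ++ (queries asked).map O`);
* `queriesAux_clockBy` — the queries of `M.clockBy t b₀` with fuel `> t w` are exactly the queries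
  of `M` within `t w` rounds (equality form of `queriesAux_clockBy_subset`); hence
  `run_traceOut_clockBy`, `run_traceOut_clockFst_boolPair`: **the clocked traced algorithm always
  halts and outputs the code of `(M.queries O (t w) w).map O`** — with the ECHO oracle `O = id`
  this is the query transcript itself;
* `isPolyTime_traceOut` — polynomial time is preserved (the stage decomposition of
  `OracleQueryMap.lean`: stage C keeps a query and replaces an output by `1 · listBool as`, the
  transcript field being part of the stage's context);
* `OracleAlg.traceFn M b₀ fuel ans c` — **the transcript function**: on `⟨x, r⟩`, the code of the
  answers of the run of `M` on `⟨x, r⟩` within `fuel(|x|)` rounds against the answer rule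
  `q ↦ ans ⟨⟨x, r⟩, q⟩` (`traceFn_boolPair`, for runs whose queries obey the length cap `c`), and
  **`traceFn_mem_FP`** for `M` polynomial-time and `ans ∈ FP` (`simFn_mem_FP`). With the echo rule
  `ans = sndF` the value is the code of the query list (`traceFn_echo_boolPair`).

## References

* S. Arora, B. Barak, *Computational Complexity: A Modern Approach*, CUP 2009, §3.4 (oracle
  machines; the configuration after `i` answers is determined by the input and those answers),
  §1.4.1 (clocked simulation).
* A. Akavia, O. Goldreich, S. Goldwasser, D. Moshkovitz, *On basing one-way functions on
  NP-hardness*, STOC 2006, Def. 1 and App. D (the verifier computes the reduction's queries).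
-/

namespace Literature.Computability.Complexity

open _root_.Computability Polynomial PrePost EmptySim Brick

namespace OracleAlg

variable {β : Type}

/-! ### The traced algorithm -/

section TraceOut

/-- **The traced algorithm**: `M.traceOut` asks what `M` asks and, when `M` outputs, outputs
instead the code `listBool as` of the answers received so far (the transcript of answers; against
the echo oracle, the transcript of queries). [cite: AroraBarak2009, §3.4] -/
def traceOut (M : OracleAlg β) : OracleAlg (List Bool) where
  step w as :=
    match M.step w as with
    | Sum.inl q => Sum.inl q
    | Sum.inr _ => Sum.inr ((encodingList Bool).listBool.encode as)

/-- The step of `M.traceOut` (definitional). [folklore] -/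
theorem traceOut_step (M : OracleAlg β) (w : List Bool) (as : List (List Bool)) :
    M.traceOut.step w as =
      match M.step w as with
      | Sum.inl q => Sum.inl q
      | Sum.inr _ => Sum.inr ((encodingList Bool).listBool.encode as) :=
  rfl

/-- Tracing does not change the queries. [folklore] -/
theorem queriesAux_traceOut (M : OracleAlg β) (O : Oracle) (w : List Bool) :
    ∀ (n : ℕ) (as : List (List Bool)), M.traceOut.queriesAux O w n as = M.queriesAux O w n as
  | 0, _ => rfl
  | n + 1, as => by
    unfold queriesAux
    rw [traceOut_step]
    cases M.step w as with
    | inl y => exact congrArg (List.cons y) (queriesAux_traceOut M O w n _)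
    | inr b => rfl

/-- Tracing does not change the queries (from the start). [folklore] -/
theorem queries_traceOut (M : OracleAlg β) (O : Oracle) (n : ℕ) (w : List Bool) :
    M.traceOut.queries O n w = M.queries O n w :=
  queriesAux_traceOut M O w n []

/-- **The output of the traced algorithm**: if `M`, continued from the transcript `as`, outputs
within `n` rounds, then `M.traceOut` outputs the code of `as` extended by the answers to the
queries asked in those rounds. [cite: AroraBarak2009, §3.4] -/
theorem runAux_traceOut (M : OracleAlg β) (O : Oracle) (w : List Bool) :
    ∀ (n : ℕ) (as : List (List Bool)) {b : β}, M.runAux O w n as = some b →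
      M.traceOut.runAux O w n as =
        some ((encodingList Bool).listBool.encode (as ++ (M.queriesAux O w n as).map O))
  | 0, _, _, h => by simp at h
  | n + 1, as, b, h => by
    revert h
    rw [runAux_succ, runAux_succ, traceOut_step]
    unfold queriesAux
    cases M.step w as with
    | inr b' =>
      intro _
      simp
    | inl y =>
      intro h
      dsimp only at h ⊢
      rw [runAux_traceOut M O w n (as ++ [O y]) h]
      simp [List.append_assoc]

/-- **The output of the traced algorithm, from the start**: the code of the answers to the
queries asked. [cite: AroraBarak2009, §3.4] -/
theorem run_traceOut (M : OracleAlg β) (O : Oracle) (w : List Bool) {n : ℕ} {b : β}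
    (h : M.run O n w = some b) :
    M.traceOut.run O n w = some ((encodingList Bool).listBool.encode ((M.queries O n w).map O)) := by
  have h' := runAux_traceOut M O w n [] h
  simpa [run, queries] using h'

/-- If `M` does not output within the fuel, neither does `M.traceOut`. [folklore] -/
theorem runAux_traceOut_eq_none (M : OracleAlg β) (O : Oracle) (w : List Bool) :
    ∀ (n : ℕ) (as : List (List Bool)), M.runAux O w n as = none → M.traceOut.runAux O w n as = none
  | 0, _, _ => rfl
  | n + 1, as, h => by
    revert h
    rw [runAux_succ, runAux_succ, traceOut_step]
    cases M.step w as with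
    | inr b' => intro h; simp at h
    | inl y => exact runAux_traceOut_eq_none M O w n (as ++ [O y])

end TraceOut

/-! ### Tracing a clocked algorithm: the transcript within `t w` rounds -/

section Clocked

/-- **The queries of the clocked algorithm** with fuel beyond the clock are exactly the queries
of `M` within the remaining `t w - |as|` rounds (equality form of `queriesAux_clockBy_subset`).
[cite: AroraBarak2009, §3.4 with §1.4.1] -/
theorem queriesAux_clockBy (M : OracleAlg β) (t : List Bool → ℕ) (b₀ : β) (O : Oracle) (w : List Bool) :
    ∀ (n : ℕ) (as : List (List Bool)), as.length ≤ t w → t w - as.length < n →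
      (M.clockBy t b₀).queriesAux O w n as = M.queriesAux O w (t w - as.length) as
  | 0, _, _, h => absurd h (Nat.not_lt_zero _)
  | n + 1, as, hle, hlt => by
    by_cases hc : as.length < t w
    · obtain ⟨m, hm⟩ : ∃ m, t w - as.length = m + 1 := ⟨t w - as.length - 1, by omega⟩
      rw [hm]
      unfold queriesAux
      rw [clockBy_step, if_pos hc]
      cases M.step w as with
      | inr b => rfl
      | inl y =>
        have h1 : (as ++ [O y]).length ≤ t w := by simp; omega
        have h2 : t w - (as ++ [O y]).length < n := by simp; omega
        have h3 : t w - (as ++ [O y]).length = m := by simp; omega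
        dsimp only
        rw [queriesAux_clockBy M t b₀ O w n _ h1 h2, h3]
    · have h0 : t w - as.length = 0 := by omega
      rw [h0]
      unfold queriesAux
      rw [clockBy_step, if_neg hc]

/-- **The traced clocked algorithm always halts, with the transcript of `M` within `t w` rounds**:
with fuel `n > t w`, `(M.clockBy t b₀).traceOut` outputs the code of
`(M.queries O (t w) w).map O`. [cite: AroraBarak2009, §3.4 with §1.4.1] -/
theorem run_traceOut_clockBy (M : OracleAlg β) (t : List Bool → ℕ) (b₀ : β) (O : Oracle)
    (w : List Bool) {n : ℕ} (hn : t w < n) :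
    (M.clockBy t b₀).traceOut.run O n w =
      some ((encodingList Bool).listBool.encode ((M.queries O (t w) w).map O)) := by
  have hrun := runAux_clockBy M t b₀ O w n [] (by simp) (by simpa using hn)
  have h := runAux_traceOut (M.clockBy t b₀) O w n [] hrun
  rw [queriesAux_clockBy M t b₀ O w n [] (by simp) (by simpa using hn)] at h
  simpa [run, queries] using h

/-- **The traced first-field-clocked algorithm on a pair input** `⟨x, r⟩` with fuel `n > q(|x|)`
outputs the code of `(M.queries O (q |x|) ⟨x, r⟩).map O`. [cite: AroraBarak2009, §3.4 with §1.4.1] -/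
theorem run_traceOut_clockFst_boolPair (M : OracleAlg β) (q : Polynomial ℕ) (b₀ : β) (O : Oracle)
    (x r : List Bool) {n : ℕ} (hn : q.eval x.length < n) :
    (M.clockFst q b₀).traceOut.run O n (boolPair x r) =
      some ((encodingList Bool).listBool.encode
        ((M.queries O (q.eval x.length) (boolPair x r)).map O)) := by
  have h := run_traceOut_clockBy M (fun w => q.eval (boolUnpair w).1.length) b₀ O (boolPair x r)
    (n := n) (by simpa using hn)
  simpa [clockFst] using h

/-- The queries of the traced first-field-clocked algorithm on `⟨x, r⟩` are queries of `M` within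
`q(|x|)` rounds. [cite: AroraBarak2009, §3.4 with §1.4.1] -/
theorem mem_queries_of_mem_queries_traceOut_clockFst (M : OracleAlg β) (q : Polynomial ℕ) (b₀ : β)
    (O : Oracle) (x r : List Bool) {n : ℕ} (hn : q.eval x.length < n) {y : List Bool}
    (hy : y ∈ (M.clockFst q b₀).traceOut.queries O n (boolPair x r)) :
    y ∈ M.queries O (q.eval x.length) (boolPair x r) := by
  rw [queries_traceOut] at hy
  have h := queriesAux_clockBy M (fun w => q.eval (boolUnpair w).1.length) b₀ O (boolPair x r) n []
    (by simp) (by simpa using hn)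
  simp only [boolUnpair_boolPair, List.length_nil, Nat.sub_zero] at h
  unfold queries at hy ⊢
  unfold clockFst at hy
  rwa [h] at hy

end Clocked

/-! ### Polynomial time -/

section PolyTime

variable (eb : Encoding β Bool)

namespace TracePoly

open QueryMapPoly

/-- Stage C of the trace (typed): keep a query, replace an output by the code of the transcript.
[folklore] -/
def stTrace (r : (List Bool ⊕ β) × (List Bool × List (List Bool))) : List Bool ⊕ List Bool :=
  match r.1 with
  | Sum.inl q => Sum.inl q
  | Sum.inr _ => Sum.inr ((encodingList Bool).listBool.encode r.2.2)

/-- The step of `M.traceOut` factors through the stages of `OracleQueryMap.lean`. [folklore] -/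
theorem uncurry_traceOut_step (M : OracleAlg β) :
    Function.uncurry M.traceOut.step =
      stTrace ∘ Prod.map (Function.uncurry M.step) id ∘ fun p : St => (p, p) := by
  funext p
  obtain ⟨x, as⟩ := p
  simp only [Function.uncurry_apply_pair, Function.comp_apply, stTrace, Prod.map_apply, id,
    traceOut_step]

/-- Stage C of the trace as a string map: after `fromField`, on `⟨tag · payload, ⟨x, LB as⟩⟩`
output `1 · LB as` if the tag is `1` (an output), the step result unchanged otherwise. [folklore] -/
noncomputable def GTrace : List (Option Bool) → List Bool :=
  iteFn (headT.eval ∘ fun z => (boolUnpair z).1)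
    (List.cons true ∘ (fun z => (boolUnpair z).2) ∘ fun z => (boolUnpair z).2)
    (fun z => (boolUnpair z).1) ∘ fromField.eval

/-- **Stage C of the trace is polynomial-time.** [cite: AroraBarak2009, §3.4 with §1.3] -/
theorem polyTime_stTrace :
    PolyTimeComputable (encQ eb) ((encodingList Bool).sumBool (encodingList Bool)).encode
      (stTrace (β := β)) := by
  have hfst : (fun z : List Bool => (boolUnpair z).1) ∈ FP := boolUnpairFst_mem_FP
  have hsnd : (fun z : List Bool => (boolUnpair z).2) ∈ FP := boolUnpairSnd_mem_FP
  have hW : (iteFn (headT.eval ∘ fun z => (boolUnpair z).1)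
      (List.cons true ∘ (fun z => (boolUnpair z).2) ∘ fun z => (boolUnpair z).2)
      (fun z => (boolUnpair z).1)) ∈ FP :=
    iteFn_mem_FP (comp_mem_FP headT.polyTimeComputable_eval hfst)
      (comp_mem_FP (cons_mem_FP true) (comp_mem_FP hsnd hsnd)) hfst
  have hS : PolyTimeComputable (id : List (Option Bool) → _) (id : List Bool → List Bool) GTrace :=
    PolyTimeComputable.comp_holds hW fromField.polyTimeComputable_eval
  refine PolyTimeComputable.of_encode hS (encQ eb) (fun _ => rfl) fun q => ?_
  obtain ⟨r, x, as⟩ := q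
  have hin : encIn (x, as) = boolPair x ((encodingList Bool).listBool.encode as) := rfl
  have hid : ∀ w : List Bool, (encodingList Bool).encode w = w := fun _ => rfl
  simp only [id, GTrace, Function.comp_apply, encQ, fromField_eval, hin]
  cases r with
  | inl y =>
    rw [iteFn_apply_false]
    · simp [stTrace, Encoding.sumBool, hid]
    · simp [headT_eval_cons, Encoding.sumBool, hid]
  | inr b =>
    rw [iteFn_apply_true]
    · simp [stTrace, Encoding.sumBool, hid]
    · simp [headT_eval_cons, Encoding.sumBool]

end TracePoly

open QueryMapPoly TracePoly

/-- **`M.traceOut` is polynomial-time** when `M` is. [cite: AroraBarak2009, §3.4 with §1.3] -/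
theorem isPolyTime_traceOut {M : OracleAlg β} (hM : M.IsPolyTime eb) :
    M.traceOut.IsPolyTime (encodingList Bool) := by
  unfold IsPolyTime
  rw [uncurry_traceOut_step]
  exact PolyTimeComputable.comp_holds (polyTime_stTrace eb)
    (PolyTimeComputable.comp_holds (polyTime_stB eb hM) polyTime_stageA)

end PolyTime

/-! ### The transcript function -/

section TraceFn

/-- **The transcript function** of `M` with round budget `fuel` (in the length of the FIRST field
of its input), default `b₀`, against the answer rule `ans` (each query `q` on outer input `u`
answered by `ans ⟨u, q⟩`), query cap `c`: the emulated output of `(M.clockFst fuel b₀).traceOut`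
(`simFn`, clocked at `fuel + 1` rounds, which always suffice). [cite: AroraBarak2009, §3.4] -/
noncomputable def traceFn (M : OracleAlg β) (b₀ : β) (fuel : Polynomial ℕ)
    (ans : List Bool → List Bool) (c : Polynomial ℕ) : List Bool → List Bool :=
  simFn (M.clockFst fuel b₀).traceOut (fun u => u) ans c (fuel + 1)

/-- **`traceFn ∈ FP`** for `M` polynomial-time and `ans ∈ FP`. [cite: AroraBarak2009, §3.4 Example 3.6 (2)] -/
theorem traceFn_mem_FP {eb : Encoding β Bool} {M : OracleAlg β} (hM : M.IsPolyTime eb) (b₀ : β)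
    (fuel : Polynomial ℕ) {ans : List Bool → List Bool} (hans : ans ∈ FP) (c : Polynomial ℕ) :
    traceFn M b₀ fuel ans c ∈ FP :=
  simFn_mem_FP (isPolyTime_traceOut eb (isPolyTime_clockFst eb hM fuel b₀))
    (PolyTimeComputable.id _) hans c (fuel + 1)

/-- **The value of the transcript function on a pair input** `⟨x, r⟩`: if every query of `M` on
`⟨x, r⟩` within `fuel(|x|)` rounds against `q ↦ ans ⟨⟨x, r⟩, q⟩` has length `≤ c(|⟨x, r⟩|)`, then
`traceFn … ⟨x, r⟩` is the code of the answers to those queries.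
[cite: AroraBarak2009, §3.4] -/
theorem traceFn_boolPair {M : OracleAlg β} {b₀ : β} {fuel c : Polynomial ℕ}
    {ans : List Bool → List Bool} {x r : List Bool}
    (hq : ∀ q ∈ M.queries (fun q => ans (boolPair (boolPair x r) q)) (fuel.eval x.length) (boolPair x r),
      q.length ≤ c.eval (boolPair x r).length) :
    traceFn M b₀ fuel ans c (boolPair x r) =
      (encodingList Bool).listBool.encode
        ((M.queries (fun q => ans (boolPair (boolPair x r) q)) (fuel.eval x.length)
          (boolPair x r)).map fun q => ans (boolPair (boolPair x r) q)) := by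
  have hn : fuel.eval x.length < (fuel + 1).eval (boolPair x r).length := by
    have hmono := TM2Iter.eval_mono fuel (show x.length ≤ (boolPair x r).length by
      rw [length_boolPair]; omega)
    simp only [eval_add, eval_one]
    omega
  refine simFn_eq_of_run (run_traceOut_clockFst_boolPair M fuel b₀ _ x r hn) fun q hq' => ?_
  exact hq q (mem_queries_of_mem_queries_traceOut_clockFst M fuel b₀ _ x r hn hq')

/-- **The echo rule yields the query transcript**: against `ans = sndF` (answer each query by
itself) the answers ARE the queries, so `traceFn M b₀ fuel sndF c ⟨x, r⟩` is the code of
`M.queries id (fuel |x|) ⟨x, r⟩` (under the length cap). For a NON-ADAPTIVE `M` this is its query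
list against every oracle. [cite: AroraBarak2009, §3.4] -/
theorem traceFn_echo_boolPair {M : OracleAlg β} {b₀ : β} {fuel c : Polynomial ℕ} {x r : List Bool}
    (hq : ∀ q ∈ M.queries (fun q => q) (fuel.eval x.length) (boolPair x r),
      q.length ≤ c.eval (boolPair x r).length) :
    traceFn M b₀ fuel sndF c (boolPair x r) =
      (encodingList Bool).listBool.encode (M.queries (fun q => q) (fuel.eval x.length) (boolPair x r)) := by
  have hecho : (fun q => sndF (boolPair (boolPair x r) q)) = fun q => q := by
    funext q
    exact sndF_boolPair _ _
  have h := traceFn_boolPair (M := M) (b₀ := b₀) (fuel := fuel) (c := c) (ans := sndF) (x := x) (r := r)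
    (by rw [hecho]; exact hq)
  rw [hecho, List.map_id'] at h
  exact h

end TraceFn

end OracleAlg

end Literature.Computability.Complexity
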